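import Literature.NumberTheory.EllipticCurves.Sprung2012.ColemanMaps
import HarnessLib

/-!
# The relative trace in the local `ℤ_p`-tower through powers of a lift of the generator:
# `Tr_{n+1/n} y = ∑_{k<p} g^{pⁿk} • y` (proofs; bookkeeping for Sprung 2012 §§3–5 / Kobayashi 2003 §8)

Topic `Literature/NumberTheory/EllipticCurves`, cluster `Sprung2012` (namespace = path). PROOF file
(one auxiliary `def`, theorems; no named fact; net debt 0) supporting `ColemanPairExistsProofs.lean`
(discharge of `prop39_exists_isColemanPair`). Setting of `Sprung2012/ColemanMaps.lean`: a
`ℤ_p`-extension `κ` of `K`, the place `v` of `K` singled out by `ι` (completion `E = K_v`), the local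
layer subgroups `Gal(K̄_v/K_n·K_v) = Kobayashi2003.localLayerSubgroupOfEmb κ ι n` with their points
`E(K_n·K_v) = localLayerPointsOfEmb κ ι W n` and trace maps `Tr_{n/m} = localTraceOfEmb κ ι W m n`
(Kobayashi, Invent. Math. 152 (2003), Def. 1.1: "`Tr_{n/m+1} : E(F_{n,p}) → E(F_{m+1,p})` is the trace
map"), and a LOCAL element `g ∈ Γ_{K_v}` restricting to the normalised topological generator
(`κ.IsTopGenerator (resGalOfEmb ι g)`, i.e. `κ(res g) = 1` — the hypothesis `hg` of
`Sprung2012.thm22_exists_isHondaSystem`; Sprung 2012 §2: "fix a topological generator `γ` of `Γ`",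
`G_n = Gal(k_n/ℚ_p)`). CONTENT (folklore Galois bookkeeping, all PROVED): `κ(res gʲ) = j`; `g^{pⁿk}`
fixes `E(K_n·K_v)`; `gʲ ∈ Gal(K̄_v/K_m·K_v) ⟺ p^m ∣ j`; every coset of `Gal(K̄_v/K_m·K_v)` in `Γ_{K_v}`
contains `g^{e}` with `e = (κ(res τ) mod p^m).val` (`genExp`); and the formula
**`localTraceOfEmb_succ_eq_sum_pow_smul`**: for `y ∈ E(K_{n+1}·K_v)`,
`Tr_{n+1/n} y = ∑_{k<p} g^{pⁿk} • y` (the `p` cosets of `Gal(K̄_v/K_{n+1}K_v)` in `Gal(K̄_v/K_nK_v)` are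
those of `g^{pⁿk}`, `k < p`) — the form in which Sprung's / Kobayashi's orbit sums `P_{n,x}(z) =
∑_σ (x^σ, z) σ` (Sprung 2012 Def. 3.1) interact with the traces (Prop. 5.5; Kobayashi Lemma 8.15).
HONEST FRAMING (LITERATURE-TYPING layer D-0088(4), cell `bsd-littype`, seat `bsd-littype-11` g3):
bookkeeping only; nothing about any curve is asserted.

References: [Kobayashi2003] Def. 1.1 (p. 2), §8 Lemma 8.15; [Sprung2012] §2 (p. 1486), Def. 3.1
(p. 1489), Prop. 5.5 (p. 1494); Washington, *Introduction to Cyclotomic Fields*, §13 (ℤ_p-extensions).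
-/

noncomputable section

open scoped Classical

open WeierstrassCurve Literature.NumberTheory.EllipticCurves Literature.NumberTheory.EllipticCurves.ZpExtension
  Literature.NumberTheory.EllipticCurves.Kobayashi2003

universe u

namespace Literature.NumberTheory.EllipticCurves.Sprung2012

section Galois

variable {K : Type u} [Field K] {p : ℕ} [Fact p.Prime] (κ : ZpExtension K p)
variable {E : Type u} [Field E] [Algebra K E] (ι : AlgebraicClosure K →ₐ[K] AlgebraicClosure E)
variable (W : WeierstrassCurve K)

/-- For a local lift `g` of a topological generator (`κ(res g) = 1`): `κ(res gʲ) = j`. [folklore] -/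
private theorem kappa_resGalOfEmb_pow {g : Field.absoluteGaloisGroup E}
    (hg : κ.IsTopGenerator (resGalOfEmb ι g)) (j : ℕ) :
    (κ (resGalOfEmb ι (g ^ j))).toAdd = (j : ℤ_[p]) := by
  rw [map_pow]
  change (κ.toContinuousMonoidHom (resGalOfEmb ι g ^ j)).toAdd = _
  rw [map_pow, toAdd_pow]
  change j • (κ (resGalOfEmb ι g)).toAdd = _
  rw [hg, toAdd_ofAdd, nsmul_eq_mul, mul_one]

/-- A point of the `n`-th local layer `E(K_n·K_v)` is fixed by `g^{pⁿ·k}` (`Γ_n = γ^{pⁿℤ_p}` fixes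
`k_n`; Sprung 2012 §2 p. 1486: "`Γ_n := Gal(k_∞/k_n)`", Kobayashi Def. 1.1: `E(F_{n,p})`).
[cite: Sprung2012, §2 p. 1486 (Γ_n = Gal(k_∞/k_n), γ ↦ 1 + X)] [cite: Kobayashi2003, Def. 1.1 (E(F_{n,p}))] -/
theorem pow_mul_smul_of_mem_localLayerPointsOfEmb {g : Field.absoluteGaloisGroup E}
    (hg : κ.IsTopGenerator (resGalOfEmb ι g)) {n : ℕ} {y : localPoints W E}
    (hy : y ∈ localLayerPointsOfEmb κ ι W n) (k : ℕ) : g ^ (p ^ n * k) • y = y := by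
  refine (mem_localLayerPointsOfEmb_iff κ ι W n y).mp hy _ ?_
  rw [mem_localLayerSubgroupOfEmb_iff, kappa_resGalOfEmb_pow κ ι hg]
  exact ⟨(k : ℤ_[p]), by push_cast; ring⟩

/-- **Every coset of `Gal(K̄_v/K_{n+1}K_v)` in `Gal(K̄_v/K_nK_v)`… contains a power of `g`**: for
`τ` in the `m`-th local layer subgroup, `τ⁻¹ g^{e} ` lies in the `n`-th one for
`e = (κ(res τ) mod p^n).val`. [folklore] -/
private theorem inv_mul_pow_mem_localLayerSubgroupOfEmb {g : Field.absoluteGaloisGroup E}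
    (hg : κ.IsTopGenerator (resGalOfEmb ι g)) (n : ℕ) (τ : Field.absoluteGaloisGroup E) :
    τ⁻¹ * g ^ (PadicInt.toZModPow n (κ (resGalOfEmb ι τ)).toAdd).val ∈
      localLayerSubgroupOfEmb κ ι n := by
  rw [mem_localLayerSubgroupOfEmb_iff, map_mul, map_inv]
  change (p : ℤ_[p]) ^ n ∣ (κ.toContinuousMonoidHom ((resGalOfEmb ι τ)⁻¹ * resGalOfEmb ι (g ^ _))).toAdd
  rw [map_mul, map_inv, toAdd_mul, toAdd_inv]
  change (p : ℤ_[p]) ^ n ∣ -(κ (resGalOfEmb ι τ)).toAdd + (κ (resGalOfEmb ι (g ^ _))).toAdd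
  rw [kappa_resGalOfEmb_pow κ ι hg, ← Ideal.mem_span_singleton, ← PadicInt.ker_toZModPow,
    RingHom.mem_ker, map_add, map_neg, map_natCast, ZMod.natCast_zmod_val, neg_add_cancel]

/-- The exponent `e(τ) := (κ(res τ) mod p^m).val < p^m` — the power of `g` representing `τ` modulo
the `m`-th local layer subgroup. [folklore] -/
private def genExp (m : ℕ) (τ : Field.absoluteGaloisGroup E) : ℕ :=
  (PadicInt.toZModPow m (κ (resGalOfEmb ι τ)).toAdd).val

/-- `e(τ) < p^m`. [folklore] -/
private theorem genExp_lt (m : ℕ) (τ : Field.absoluteGaloisGroup E) : genExp κ ι m τ < p ^ m := by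
  haveI : NeZero (p ^ m) := ⟨pow_ne_zero _ (Fact.out : p.Prime).ne_zero⟩
  exact ZMod.val_lt _

/-- `τ⁻¹ g^{e(τ)}` lies in the `m`-th local layer subgroup. [folklore] -/
private theorem inv_mul_pow_genExp_mem {g : Field.absoluteGaloisGroup E}
    (hg : κ.IsTopGenerator (resGalOfEmb ι g)) (m : ℕ) (τ : Field.absoluteGaloisGroup E) :
    τ⁻¹ * g ^ genExp κ ι m τ ∈ localLayerSubgroupOfEmb κ ι m :=
  inv_mul_pow_mem_localLayerSubgroupOfEmb κ ι hg m τ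

/-- `e` is constant on cosets of the `m`-th local layer subgroup. [folklore] -/
private theorem genExp_eq_of_inv_mul_mem (m : ℕ) {τ τ' : Field.absoluteGaloisGroup E}
    (h : τ⁻¹ * τ' ∈ localLayerSubgroupOfEmb κ ι m) : genExp κ ι m τ = genExp κ ι m τ' := by
  rw [mem_localLayerSubgroupOfEmb_iff, map_mul, map_inv] at h
  change (p : ℤ_[p]) ^ m ∣ (κ.toContinuousMonoidHom ((resGalOfEmb ι τ)⁻¹ * resGalOfEmb ι τ')).toAdd at h
  rw [map_mul, map_inv, toAdd_mul, toAdd_inv, ← Ideal.mem_span_singleton, ← PadicInt.ker_toZModPow,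
    RingHom.mem_ker, map_add, map_neg, neg_add_eq_zero] at h
  unfold genExp
  exact congrArg ZMod.val h

/-- `e(gʲ) = j mod p^m`. [folklore] -/
private theorem genExp_pow {g : Field.absoluteGaloisGroup E} (hg : κ.IsTopGenerator (resGalOfEmb ι g))
    (m j : ℕ) : genExp κ ι m (g ^ j) = j % p ^ m := by
  unfold genExp
  rw [kappa_resGalOfEmb_pow κ ι hg, map_natCast, ZMod.val_natCast]

/-- `gʲ` lies in the `m`-th local layer subgroup iff `p^m ∣ j`. [folklore] -/
private theorem pow_mem_localLayerSubgroupOfEmb_iff {g : Field.absoluteGaloisGroup E}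
    (hg : κ.IsTopGenerator (resGalOfEmb ι g)) (m j : ℕ) :
    g ^ j ∈ localLayerSubgroupOfEmb κ ι m ↔ p ^ m ∣ j := by
  rw [mem_localLayerSubgroupOfEmb_iff, kappa_resGalOfEmb_pow κ ι hg]
  have h := PadicInt.pow_p_dvd_int_iff (p := p) m (j : ℤ)
  rw [Int.cast_natCast] at h
  rw [h, ← Nat.cast_pow]
  exact Int.natCast_dvd_natCast

/-- **The relative trace through powers of the generator**: for `y` in the `(n+1)`-st local layer,
`Tr_{n+1/n} y = ∑_{k<p} g^{pⁿ k} • y` — the trace of the source ("`Tr_{n/m+1} : E(F_{n,p}) → E(F_{m+1,p})`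
is the trace map", Kobayashi Def. 1.1; Sprung 2012 Thm. 2.2 "`Tr_{n+1/n}`"), summed over the coset
representatives `g^{pⁿk}`, `k < p`, of `Gal(K̄_v/K_{n+1}K_v)` in `Gal(K̄_v/K_nK_v)`.
[cite: Kobayashi2003, Def. 1.1 (the trace maps Tr_{n/m+1})] [cite: Sprung2012, Thm. 2.2 (p. 1487) (Tr_{n+1/n} on Ê(𝔪_{n+1}))] -/
theorem localTraceOfEmb_succ_eq_sum_pow_smul {g : Field.absoluteGaloisGroup E}
    (hg : κ.IsTopGenerator (resGalOfEmb ι g)) (n : ℕ) {y : localPoints W E}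
    (hy : y ∈ localLayerPointsOfEmb κ ι W (n + 1)) :
    localTraceOfEmb κ ι W n (n + 1) y = ∑ k ∈ Finset.range p, g ^ (p ^ n * k) • y := by
  classical
  haveI : Fintype (localLayerSubgroupOfEmb κ ι n ⧸
      (localLayerSubgroupOfEmb κ ι (n + 1)).subgroupOf (localLayerSubgroupOfEmb κ ι n)) :=
    Fintype.ofFinite _
  have hp : 0 < p := (Fact.out : p.Prime).pos
  have hpn : 0 < p ^ n := pow_pos hp n
  -- the exponent of a coset and the section by powers of `g`
  set e : (localLayerSubgroupOfEmb κ ι n ⧸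
      (localLayerSubgroupOfEmb κ ι (n + 1)).subgroupOf (localLayerSubgroupOfEmb κ ι n)) → ℕ :=
    fun q => genExp κ ι (n + 1) ((q.out : localLayerSubgroupOfEmb κ ι n) : Field.absoluteGaloisGroup E)
    with he
  have hmem : ∀ q : localLayerSubgroupOfEmb κ ι n ⧸
      (localLayerSubgroupOfEmb κ ι (n + 1)).subgroupOf (localLayerSubgroupOfEmb κ ι n), g ^ e q ∈ localLayerSubgroupOfEmb κ ι n := by
    intro q
    have h1 := localLayerSubgroupOfEmb_antitone κ ι (Nat.le_succ n)
      (inv_mul_pow_genExp_mem κ ι hg (n + 1) ((q.out : localLayerSubgroupOfEmb κ ι n) : _))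
    have h2 := Subgroup.mul_mem _ (q.out : localLayerSubgroupOfEmb κ ι n).2 h1
    rwa [mul_inv_cancel_left] at h2
  set s : (localLayerSubgroupOfEmb κ ι n ⧸
      (localLayerSubgroupOfEmb κ ι (n + 1)).subgroupOf (localLayerSubgroupOfEmb κ ι n)) → localLayerSubgroupOfEmb κ ι n :=
    fun q => ⟨g ^ e q, hmem q⟩ with hs_def
  have hs : ∀ q, (QuotientGroup.mk (s q) : localLayerSubgroupOfEmb κ ι n ⧸
      (localLayerSubgroupOfEmb κ ι (n + 1)).subgroupOf (localLayerSubgroupOfEmb κ ι n)) = q := by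
    intro q
    conv_rhs => rw [← QuotientGroup.out_eq' q]
    rw [QuotientGroup.eq, Subgroup.mem_subgroupOf, Subgroup.coe_mul, Subgroup.coe_inv]
    have h1 := inv_mul_pow_genExp_mem κ ι hg (n + 1) ((q.out : localLayerSubgroupOfEmb κ ι n) : _)
    have h2 := Subgroup.inv_mem _ h1
    rwa [mul_inv_rev, inv_inv] at h2
  rw [localTraceOfEmb_apply_eq_sum_of_mem κ ι W n (n + 1) hy s hs]
  -- every `e q` is a multiple of `pⁿ` below `p^{n+1}`
  have hdvd : ∀ q : localLayerSubgroupOfEmb κ ι n ⧸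
      (localLayerSubgroupOfEmb κ ι (n + 1)).subgroupOf (localLayerSubgroupOfEmb κ ι n), p ^ n ∣ e q := fun q =>
    (pow_mem_localLayerSubgroupOfEmb_iff κ ι hg n (e q)).mp (hmem q)
  have hlt : ∀ q : localLayerSubgroupOfEmb κ ι n ⧸
      (localLayerSubgroupOfEmb κ ι (n + 1)).subgroupOf (localLayerSubgroupOfEmb κ ι n), e q < p ^ (n + 1) := fun q => genExp_lt κ ι _ _
  refine Finset.sum_bij (fun q _ => e q / p ^ n) ?_ ?_ ?_ ?_
  · intro q _
    rw [Finset.mem_range, Nat.div_lt_iff_lt_mul hpn, ← pow_succ']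
    exact hlt q
  · intro q₁ _ q₂ _ h12
    have h' : e q₁ = e q₂ := by
      rw [← Nat.div_mul_cancel (hdvd q₁), ← Nat.div_mul_cancel (hdvd q₂), h12]
    have hsq : s q₁ = s q₂ := Subtype.ext (by simp only [hs_def, h'])
    rw [← hs q₁, ← hs q₂, hsq]
  · intro k hk
    rw [Finset.mem_range] at hk
    have hmemk : g ^ (p ^ n * k) ∈ localLayerSubgroupOfEmb κ ι n :=
      (pow_mem_localLayerSubgroupOfEmb_iff κ ι hg n _).mpr (dvd_mul_right _ _)
    refine ⟨QuotientGroup.mk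
      (s := (localLayerSubgroupOfEmb κ ι (n + 1)).subgroupOf (localLayerSubgroupOfEmb κ ι n))
      ⟨g ^ (p ^ n * k), hmemk⟩, Finset.mem_univ _, ?_⟩
    -- `e` of this coset is `pⁿ k`
    obtain ⟨h, hh⟩ := QuotientGroup.mk_out_eq_mul
      ((localLayerSubgroupOfEmb κ ι (n + 1)).subgroupOf (localLayerSubgroupOfEmb κ ι n))
      ⟨g ^ (p ^ n * k), hmemk⟩
    have hex : e (QuotientGroup.mk
        (s := (localLayerSubgroupOfEmb κ ι (n + 1)).subgroupOf (localLayerSubgroupOfEmb κ ι n))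
        ⟨g ^ (p ^ n * k), hmemk⟩) = p ^ n * k := by
      simp only [he]
      rw [hh, Subgroup.coe_mul]
      have hinv : ((⟨g ^ (p ^ n * k), hmemk⟩ * (h : localLayerSubgroupOfEmb κ ι n) :
            localLayerSubgroupOfEmb κ ι n) : Field.absoluteGaloisGroup E)⁻¹ * g ^ (p ^ n * k) ∈
          localLayerSubgroupOfEmb κ ι (n + 1) := by
        rw [Subgroup.coe_mul, mul_inv_rev, mul_assoc, inv_mul_cancel, mul_one]
        exact Subgroup.inv_mem _ (Subgroup.mem_subgroupOf.mp h.2)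
      rw [← Subgroup.coe_mul, genExp_eq_of_inv_mul_mem κ ι (n + 1) hinv, genExp_pow κ ι hg,
        Nat.mod_eq_of_lt]
      calc p ^ n * k < p ^ n * p := Nat.mul_lt_mul_of_pos_left hk hpn
        _ = p ^ (n + 1) := (pow_succ p n).symm
    rw [hex, Nat.mul_div_cancel_left _ hpn]
  · intro q _
    simp only [hs_def]
    rw [Nat.mul_div_cancel' (hdvd q)]

end Galois

end Literature.NumberTheory.EllipticCurves.Sprung2012

end
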